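import Literature.Analysis.FluidPDE.PartialRegularity
import Literature.Analysis.FluidPDE.KNSSLiouville
import HarnessLib

/-!
# Type I ancient solutions versus constants and the Liouville conjecture (Albritton–Barker 2019, §1)

Topic `Literature/Analysis/FluidPDE`; companion of `PartialRegularity.lean` (the named propositions
`Literature.Analysis.FluidPDE.NontrivialTypeIAncientExists`, `TypeISingularityExists` and the named
fact `albritton_barker := TypeISingularityExists ↔ NontrivialTypeIAncientExists`) and of
`SelfSimilarLiouville.lean` (`Literature.Analysis.FluidPDE.LiouvilleConjectureNS`, the conjecture
(L) of Koch–Nadirashvili–Seregin–Šverák 2009).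

D. Albritton, T. Barker, *On local Type I singularities of the Navier–Stokes equations and
Liouville theorems*, J. Math. Fluid Mech. 21 (2019), Paper No. 43 (arXiv:1811.00502), §1, prove
Theorem 1.1: "The following are equivalent: • There exists a suitable weak solution with Type I
singular point. • There exists a non-trivial mild bounded ancient solution with `𝐈 < ∞`", and
remark, right after the display defining `𝐈(ω)`: "Together, `v ≡ const.` and `𝐈 < ∞` imply
`v ≡ 0`", and, about (L): "If true, the conjecture excludes Type I singularities."

## What this file proves (sorry-free), and what it deliberately does not

`NontrivialTypeIAncientExists` is the *right-hand side* of Theorem 1.1, an **open** existence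
statement (a witness is a Type I blow-up profile of the three-dimensional Navier–Stokes
equations); the paper asserts only the equivalence, and under (L) the statement is expected to be
false. This file records the printed remark for the accepted quantities
(`Literature.Analysis.FluidPDE.cknSum = A + C + D + E` with `FluidPDE.cknA/C/D/E`, suprema in
`ℝ≥0∞` over all `r > 0` and all centres `z` with `t < 0`, exactly the bound appearing in
`NontrivialTypeIAncientExists`):

* `eq_zero_of_slice_ae_eq_const_of_typeIBound`: if the Type I bound
  `⨆_{r > 0, z.1 < 0} (A + C + D + E)(r, z) < ∞` holds and a slice `u t`, `t < 0`, is a.e. equal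
  to a constant `b`, then `b = 0` (the scaled energy of a constant slice at scale `r` is
  `r² |B₁| ‖b‖²`, unbounded in `r`);
* `slices_ae_eq_zero_of_typeIBound`: hence a field all of whose slices are a.e. constant
  (the conclusion of (L)) and which obeys the Type I bound vanishes a.e. on every slice;
* `LiouvilleConjectureNS.slices_ae_eq_zero_of_typeIBound`, `….ae_eq_zero_slab_of_typeIBound`:
  under (L), a bounded ancient mild solution with a.e.-strongly measurable slices obeying the
  Type I bound is a.e. zero (slice-wise, and on the slab `(-∞, 0) × ℝ³` when `u` is jointly
  a.e.-strongly measurable there);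
* `LiouvilleConjectureNS.exists_not_aestronglyMeasurable_slice_of_typeIBound` and
  `LiouvilleConjectureNS.not_nontrivialTypeIAncientExists_measurable`: under (L), every witness
  `(u, p, G)` of `NontrivialTypeIAncientExists` has a slice `u t`, `t < 0`, which is **not**
  a.e.-strongly measurable; equivalently, (L) refutes the variant of
  `NontrivialTypeIAncientExists` with measurable slices;
* `not_liouvilleConjectureNS_of_nontrivialTypeIAncient_measurable`: the sanity link — that
  variant is literally `NontrivialTypeIAncientExists` plus one measurability clause, and a
  witness of it gives `NontrivialTypeIAncientExists ∧ ¬ LiouvilleConjectureNS`.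

NOT proved here: `NontrivialTypeIAncientExists` itself (open), its negation (open; it would
exclude Type I blow-up), and the unconditional implication
`LiouvilleConjectureNS → ¬ NontrivialTypeIAncientExists`: the accepted duality-form class
`FluidPDE.IsBoundedAncientMildSolution` carries no per-slice measurability, whereas (L) as vendored
asks for `AEStronglyMeasurable (u t)` at every `t < 0`, and the remaining clauses of
`NontrivialTypeIAncientExists` give joint local integrability only (measurable slices for a.e.
`t`). The measurability proviso above is exactly that gap.

## References

* D. Albritton, T. Barker, J. Math. Fluid Mech. 21 (2019), no. 43 = arXiv:1811.00502, §1,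
  Thm 1.1 and the displays following it (`A`, `C`, `D`, `E`, `𝐈(ω)`, the Type I notion).
* G. Koch, N. Nadirashvili, G. Seregin, V. Šverák, Acta Math. 203 (2009), §1 (conjecture (L)).
-/

noncomputable section

open MeasureTheory Set Function Filter Metric
open scoped ENNReal NNReal Topology

namespace Literature.Analysis.FluidPDE

section TypeIAncientLiouville

variable {u : ℝ → (EuclideanSpace ℝ (Fin 3)) → (EuclideanSpace ℝ (Fin 3))}
  {p : ℝ → (EuclideanSpace ℝ (Fin 3)) → ℝ} {G : ℝ → (EuclideanSpace ℝ (Fin 3)) → (EuclideanSpace ℝ (Fin 3)) →L[ℝ] (EuclideanSpace ℝ (Fin 3))}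

/-- A single time slice of the scaled energy bounds `A + C + D + E` from below: for
`t ∈ (t₀ - r², t₀)` and `z = (t₀, x₀)`,
`r⁻¹ ∫_{B_r(x₀)} |u(t)|² ≤ A(r, z) ≤ (A + C + D + E)(r, z)`
(Albritton–Barker 2019, §1, the displays defining `A` and `𝐈` after Thm 1.1).
[cite: AlbrittonBarker2019, §1 after Thm 1.1] -/
theorem setLIntegral_ball_le_cknSum {r t : ℝ} {z : ℝ × (EuclideanSpace ℝ (Fin 3))}
    (ht : t ∈ Ioo (z.1 - r ^ 2) z.1) :
    (ENNReal.ofReal r)⁻¹ * ∫⁻ x in ball z.2 r, ‖u t x‖ₑ ^ 2 ≤ cknSum r z u p G := by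
  calc (ENNReal.ofReal r)⁻¹ * ∫⁻ x in ball z.2 r, ‖u t x‖ₑ ^ 2
      ≤ FluidPDE.cknA r z u := by
        unfold FluidPDE.cknA
        exact le_iSup₂_of_le t ht le_rfl
    _ ≤ cknSum r z u p G := by
        rw [cknSum_def]
        exact le_add_right (le_add_right le_self_add)

/-- The `L²`-mass of an a.e. constant slice on a set: `∫_s ‖v‖² = ‖b‖² |s|` when `v = b` a.e.
(Lebesgue integral of a constant). [folklore] -/
theorem setLIntegral_enorm_sq_of_ae_eq_const {α F : Type*} [MeasurableSpace α] {μ : Measure α}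
    [ENorm F] {v : α → F} {b : F} (hb : v =ᵐ[μ] fun _ => b) (s : Set α) :
    ∫⁻ x in s, ‖v x‖ₑ ^ 2 ∂μ = ‖b‖ₑ ^ 2 * μ s := by
  rw [← setLIntegral_const s (‖b‖ₑ ^ 2)]
  refine lintegral_congr_ae ?_
  filter_upwards [ae_restrict_of_ae (s := s) hb] with x hx
  simp [hx]

/-- Volume of balls in `ℝ³`: `|B_r(x)| = r³ |B₁(0)|` for `r > 0` (Lebesgue measure is an additive
Haar measure; `dim ℝ³ = 3`). [folklore] -/
theorem volume_ball_eq_ofReal_pow_three_mul (x : (EuclideanSpace ℝ (Fin 3))) {r : ℝ} (hr : 0 < r) :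
    volume (ball x r) = ENNReal.ofReal (r ^ 3) * volume (ball (0 : (EuclideanSpace ℝ (Fin 3))) 1) := by
  rw [Measure.addHaar_ball_of_pos volume x hr, finrank_euclideanSpace_fin]

/-- **Constants are excluded by the Type I bound** (Albritton–Barker 2019, §1, the sentence
after the definition of `𝐈(ω)`: "Together, `v ≡ const.` and `𝐈 < ∞` imply `v ≡ 0`"), slice
form for the accepted quantities: if
`⨆_{r > 0, z = (t₀, x₀), t₀ < 0} (A + C + D + E)(r, z) < ∞` and the slice `u t`, `t < 0`, is
a.e. equal to the constant `b`, then `b = 0`. Proof: centring a cylinder `Q_r(z)`, `z = (t₀, 0)`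
with `t < t₀ < min(0, t + r²)`, the slice contributes `r⁻¹ ∫_{B_r} ‖b‖² = r² |B₁| ‖b‖²` to
`A(r, z)`, which is unbounded in `r` unless `b = 0`. [cite: AlbrittonBarker2019, §1 after Thm 1.1] -/
theorem eq_zero_of_slice_ae_eq_const_of_typeIBound
    (hI : (⨆ (r : ℝ) (_ : 0 < r) (z : ℝ × (EuclideanSpace ℝ (Fin 3))) (_ : z.1 < 0), cknSum r z u p G) < ∞)
    {t : ℝ} (ht : t < 0) {b : (EuclideanSpace ℝ (Fin 3))} (hb : u t =ᵐ[volume] fun _ => b) : b = 0 := by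
  by_contra hb0
  set V : ℝ≥0∞ := volume (ball (0 : (EuclideanSpace ℝ (Fin 3))) 1) with hV
  have hV0 : V ≠ 0 := (measure_ball_pos volume (0 : (EuclideanSpace ℝ (Fin 3))) one_pos).ne'
  have hb_ne : ‖b‖ₑ ^ 2 ≠ 0 := pow_ne_zero 2 (enorm_ne_zero.2 hb0)
  set c : ℝ≥0∞ := ‖b‖ₑ ^ 2 * V with hc
  have hc0 : c ≠ 0 := mul_ne_zero hb_ne hV0
  -- the key lower bound at every scale `r > 0`
  have key : ∀ r : ℝ, 0 < r →
      c * ENNReal.ofReal (r ^ 2) ≤ ⨆ (r : ℝ) (_ : 0 < r) (z : ℝ × (EuclideanSpace ℝ (Fin 3))) (_ : z.1 < 0),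
        cknSum r z u p G := by
    intro r hr
    -- centre `z = (t + δ, 0)` with `0 < δ < r²` and `t + δ < 0`
    set δ : ℝ := min (r ^ 2 / 2) (-t / 2) with hδ
    have hδpos : 0 < δ := lt_min (by positivity) (by linarith)
    have hδr : δ < r ^ 2 := (min_le_left _ _).trans_lt (by nlinarith [sq_nonneg r, hr])
    have hδt : t + δ < 0 := by
      have := min_le_right (r ^ 2 / 2) (-t / 2)
      linarith
    set z : ℝ × (EuclideanSpace ℝ (Fin 3)) := (t + δ, 0) with hz
    have hz1 : z.1 < 0 := hδt
    have htmem : t ∈ Ioo (z.1 - r ^ 2) z.1 := ⟨by show t + δ - r ^ 2 < t; linarith, by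
      show t < t + δ; linarith⟩
    have hinv : (ENNReal.ofReal r)⁻¹ * ENNReal.ofReal r = 1 :=
      ENNReal.inv_mul_cancel (ENNReal.ofReal_pos.2 hr).ne' ENNReal.ofReal_ne_top
    calc c * ENNReal.ofReal (r ^ 2)
        = (ENNReal.ofReal r)⁻¹ * ENNReal.ofReal r * (‖b‖ₑ ^ 2 * V * ENNReal.ofReal (r ^ 2)) := by
          rw [hinv, one_mul]
      _ = (ENNReal.ofReal r)⁻¹ * (‖b‖ₑ ^ 2 * volume (ball z.2 r)) := by
          rw [show z.2 = (0 : (EuclideanSpace ℝ (Fin 3))) from rfl, volume_ball_eq_ofReal_pow_three_mul 0 hr,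
            show r ^ 3 = r * r ^ 2 by ring, ENNReal.ofReal_mul hr.le]
          ring
      _ = (ENNReal.ofReal r)⁻¹ * ∫⁻ x in ball z.2 r, ‖u t x‖ₑ ^ 2 := by
          rw [setLIntegral_enorm_sq_of_ae_eq_const hb]
      _ ≤ cknSum r z u p G := setLIntegral_ball_le_cknSum htmem
      _ ≤ ⨆ (r : ℝ) (_ : 0 < r) (z : ℝ × (EuclideanSpace ℝ (Fin 3))) (_ : z.1 < 0), cknSum r z u p G :=
          le_iSup₂_of_le r hr (le_iSup₂_of_le z hz1 le_rfl)
  -- hence `c * n ≤ 𝐈` for every `n : ℕ`, i.e. `c * ∞ ≤ 𝐈 < ∞` with `c ≠ 0`: contradiction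
  have hcn : ∀ n : ℕ, c * (n : ℝ≥0∞) ≤ ⨆ (r : ℝ) (_ : 0 < r) (z : ℝ × (EuclideanSpace ℝ (Fin 3))) (_ : z.1 < 0),
      cknSum r z u p G := by
    intro n
    have h1 : (n : ℝ≥0∞) ≤ ENNReal.ofReal (((n : ℝ) + 1) ^ 2) := by
      rw [← ENNReal.ofReal_natCast n]
      exact ENNReal.ofReal_le_ofReal (by nlinarith [sq_nonneg (n : ℝ), (n.cast_nonneg : (0 : ℝ) ≤ n)])
    calc c * (n : ℝ≥0∞) ≤ c * ENNReal.ofReal (((n : ℝ) + 1) ^ 2) := by gcongr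
      _ ≤ _ := key ((n : ℝ) + 1) (by positivity)
  have htop : c * ∞ ≤ ⨆ (r : ℝ) (_ : 0 < r) (z : ℝ × (EuclideanSpace ℝ (Fin 3))) (_ : z.1 < 0), cknSum r z u p G := by
    rw [← ENNReal.iSup_natCast, ENNReal.mul_iSup]
    exact iSup_le hcn
  rw [ENNReal.mul_top hc0] at htop
  exact (lt_irrefl _) (htop.trans_lt hI)

/-- **Constants are excluded by the Type I bound**, all slices (Albritton–Barker 2019, §1, sentence after
the definition of `𝐈(ω)`): if every slice `u t`, `t < 0`, is a.e. equal to some constant (the conclusion of the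
Liouville conjecture (L), `LiouvilleConjectureNS`) and the Type I bound
`⨆_{r > 0, t₀ < 0} (A + C + D + E) < ∞` holds, then `u t = 0` a.e. for every `t < 0`. [cite: AlbrittonBarker2019, §1 after Thm 1.1] -/
theorem slices_ae_eq_zero_of_typeIBound
    (hI : (⨆ (r : ℝ) (_ : 0 < r) (z : ℝ × (EuclideanSpace ℝ (Fin 3))) (_ : z.1 < 0), cknSum r z u p G) < ∞)
    (hconst : ∀ t < 0, ∃ b : (EuclideanSpace ℝ (Fin 3)), u t =ᵐ[volume] fun _ => b) :
    ∀ t < 0, u t =ᵐ[volume] 0 := by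
  intro t ht
  obtain ⟨b, hb⟩ := hconst t ht
  obtain rfl := eq_zero_of_slice_ae_eq_const_of_typeIBound hI ht hb
  exact hb

/-- **(L) excludes Type I ancient solutions with measurable slices, slice form**
(Albritton–Barker 2019, §1: "If true, the conjecture excludes Type I singularities"; here the
elementary half "`v ≡ const.` and `𝐈 < ∞` imply `v ≡ 0`"): under `LiouvilleConjectureNS`, a
bounded ancient mild solution (`ν = 1`) with a.e.-strongly measurable slices obeying the Type I
bound of `NontrivialTypeIAncientExists` vanishes a.e. on every slice `t < 0`. [cite: AlbrittonBarker2019, §1 after Thm 1.1] -/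
theorem LiouvilleConjectureNS.slices_ae_eq_zero_of_typeIBound (hL : LiouvilleConjectureNS)
    (hu : FluidPDE.IsBoundedAncientMildSolution 1 u)
    (hmeas : ∀ t < 0, AEStronglyMeasurable (u t) volume)
    (hI : (⨆ (r : ℝ) (_ : 0 < r) (z : ℝ × (EuclideanSpace ℝ (Fin 3))) (_ : z.1 < 0), cknSum r z u p G) < ∞) :
    ∀ t < 0, u t =ᵐ[volume] 0 :=
  Literature.Analysis.FluidPDE.slices_ae_eq_zero_of_typeIBound hI (hL u hu hmeas)

/-- **(L) excludes Type I ancient solutions with measurable slices, space–time form**: under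
`LiouvilleConjectureNS`, a bounded ancient mild solution (`ν = 1`) with a.e.-strongly measurable
slices, jointly a.e.-strongly measurable on the slab `(-∞, 0) × ℝ³`, obeying the Type I bound of
`NontrivialTypeIAncientExists`, is a.e. zero on the slab (slice form +
`ae_eq_zero_slab_of_ae_slice`). [cite: AlbrittonBarker2019, §1 after Thm 1.1] -/
theorem LiouvilleConjectureNS.ae_eq_zero_slab_of_typeIBound (hL : LiouvilleConjectureNS)
    (hu : FluidPDE.IsBoundedAncientMildSolution 1 u)
    (hmeas : ∀ t < 0, AEStronglyMeasurable (u t) volume)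
    (hjoint : AEStronglyMeasurable (uncurry u)
      (volume.restrict (Iio (0 : ℝ) ×ˢ (univ : Set (EuclideanSpace ℝ (Fin 3))))))
    (hI : (⨆ (r : ℝ) (_ : 0 < r) (z : ℝ × (EuclideanSpace ℝ (Fin 3))) (_ : z.1 < 0), cknSum r z u p G) < ∞) :
    uncurry u =ᵐ[volume.restrict (Iio (0 : ℝ) ×ˢ (univ : Set (EuclideanSpace ℝ (Fin 3))))] 0 := by
  have hslice : ∀ᵐ t ∂(volume.restrict (Iio (0 : ℝ))), u t =ᵐ[volume] 0 :=
    (ae_restrict_iff' measurableSet_Iio).2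
      (Eventually.of_forall (hL.slices_ae_eq_zero_of_typeIBound hu hmeas hI))
  filter_upwards [ae_eq_zero_slab_of_ae_slice hjoint hslice] with z hz
  exact hz

/-- **Under (L), a witness of `NontrivialTypeIAncientExists` must have a non-measurable slice.**
If `LiouvilleConjectureNS` holds and `(u, p, G)` satisfies the clauses of
`NontrivialTypeIAncientExists` that matter here — `u` is a bounded ancient mild solution
(`ν = 1`), `G` is a weak spatial gradient of `u` on the slab `(-∞, 0) × ℝ³` (whence `u` is
locally integrable, so jointly a.e.-strongly measurable, there), `u` is not a.e. zero on the slab,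
and the Type I bound holds — then some slice `u t`, `t < 0`, is not a.e.-strongly measurable.
(Albritton–Barker 2019, §1: constants are excluded by `𝐈 < ∞`; the measurability gap is that of
the accepted duality-form class, see the module docstring.) [cite: AlbrittonBarker2019, §1 after Thm 1.1] -/
theorem LiouvilleConjectureNS.exists_not_aestronglyMeasurable_slice_of_typeIBound
    (hL : LiouvilleConjectureNS) (hu : FluidPDE.IsBoundedAncientMildSolution 1 u)
    (hG : FluidPDE.HasWeakSpatialGradientOn (FluidPDE.slab (EuclideanSpace ℝ (Fin 3)) (Iio 0) isOpen_Iio) u G)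
    (hne : ¬ (uncurry u =ᵐ[volume.restrict (Iio (0 : ℝ) ×ˢ (univ : Set (EuclideanSpace ℝ (Fin 3))))] 0))
    (hI : (⨆ (r : ℝ) (_ : 0 < r) (z : ℝ × (EuclideanSpace ℝ (Fin 3))) (_ : z.1 < 0), cknSum r z u p G) < ∞) :
    ∃ t < 0, ¬ AEStronglyMeasurable (u t) volume := by
  by_contra h
  have h' : ∀ t < 0, AEStronglyMeasurable (u t) volume := fun t ht => by
    by_contra hnt
    exact h ⟨t, ht, hnt⟩
  exact hne (hL.ae_eq_zero_slab_of_typeIBound hu h' hG.locallyIntegrableOn.aestronglyMeasurable hI)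

/-- **(L) refutes `NontrivialTypeIAncientExists` up to slice measurability.** Under
`LiouvilleConjectureNS` there is no triple `(u, p, G)` satisfying the five clauses of
`Literature.Analysis.FluidPDE.NontrivialTypeIAncientExists` (bounded ancient mild solution,
suitable weak solution on `(-∞, 0) × ℝ³` with pressure `p`, weak spatial gradient `G`,
non-triviality, Type I bound `⨆ (A + C + D + E) < ∞`) **and** having a.e.-strongly measurable
slices `u t` at every `t < 0` (Albritton–Barker 2019, §1: "If true, the conjecture excludes
Type I singularities" — the elementary half, constants being excluded by `𝐈 < ∞`). The
unconditional `LiouvilleConjectureNS → ¬ NontrivialTypeIAncientExists` is not claimed (module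
docstring). [cite: AlbrittonBarker2019, §1 after Thm 1.1] -/
theorem LiouvilleConjectureNS.not_nontrivialTypeIAncientExists_measurable
    (hL : LiouvilleConjectureNS) :
    ¬ ∃ (u : ℝ → (EuclideanSpace ℝ (Fin 3)) → (EuclideanSpace ℝ (Fin 3))) (p : ℝ → (EuclideanSpace ℝ (Fin 3)) → ℝ)
        (G : ℝ → (EuclideanSpace ℝ (Fin 3)) → (EuclideanSpace ℝ (Fin 3)) →L[ℝ] (EuclideanSpace ℝ (Fin 3))),
      (∀ t < 0, AEStronglyMeasurable (u t) volume) ∧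
      FluidPDE.IsBoundedAncientMildSolution 1 u ∧
      FluidPDE.IsSuitableWeakSolutionOn (FluidPDE.slab (EuclideanSpace ℝ (Fin 3)) (Iio 0) isOpen_Iio) 1 0 u p ∧
      FluidPDE.HasWeakSpatialGradientOn (FluidPDE.slab (EuclideanSpace ℝ (Fin 3)) (Iio 0) isOpen_Iio) u G ∧
      ¬ (uncurry u =ᵐ[volume.restrict (Iio (0 : ℝ) ×ˢ (univ : Set (EuclideanSpace ℝ (Fin 3))))] 0) ∧
      (⨆ (r : ℝ) (_ : 0 < r) (z : ℝ × (EuclideanSpace ℝ (Fin 3))) (_ : z.1 < 0), cknSum r z u p G) < ∞ := by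
  rintro ⟨u, p, G, hmeas, hu, -, hG, hne, hI⟩
  obtain ⟨t, ht, hnot⟩ := hL.exists_not_aestronglyMeasurable_slice_of_typeIBound hu hG hne hI
  exact hnot (hmeas t ht)

/-- Sanity link with the accepted named proposition: dropping the measurability clause from the
statement refuted above gives back exactly `NontrivialTypeIAncientExists`; in particular a
witness of `NontrivialTypeIAncientExists` with measurable slices would contradict (L)
(contrapositive packaging of `not_nontrivialTypeIAncientExists_measurable`). [cite: AlbrittonBarker2019, §1 after Thm 1.1] -/
theorem not_liouvilleConjectureNS_of_nontrivialTypeIAncient_measurable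
    (h : ∃ (u : ℝ → (EuclideanSpace ℝ (Fin 3)) → (EuclideanSpace ℝ (Fin 3))) (p : ℝ → (EuclideanSpace ℝ (Fin 3)) → ℝ)
        (G : ℝ → (EuclideanSpace ℝ (Fin 3)) → (EuclideanSpace ℝ (Fin 3)) →L[ℝ] (EuclideanSpace ℝ (Fin 3))),
      (∀ t < 0, AEStronglyMeasurable (u t) volume) ∧
      FluidPDE.IsBoundedAncientMildSolution 1 u ∧
      FluidPDE.IsSuitableWeakSolutionOn (FluidPDE.slab (EuclideanSpace ℝ (Fin 3)) (Iio 0) isOpen_Iio) 1 0 u p ∧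
      FluidPDE.HasWeakSpatialGradientOn (FluidPDE.slab (EuclideanSpace ℝ (Fin 3)) (Iio 0) isOpen_Iio) u G ∧
      ¬ (uncurry u =ᵐ[volume.restrict (Iio (0 : ℝ) ×ˢ (univ : Set (EuclideanSpace ℝ (Fin 3))))] 0) ∧
      (⨆ (r : ℝ) (_ : 0 < r) (z : ℝ × (EuclideanSpace ℝ (Fin 3))) (_ : z.1 < 0), cknSum r z u p G) < ∞) :
    NontrivialTypeIAncientExists ∧ ¬ LiouvilleConjectureNS := by
  refine ⟨?_, fun hL => hL.not_nontrivialTypeIAncientExists_measurable h⟩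
  obtain ⟨u, p, G, -, hu, hs, hG, hne, hI⟩ := h
  exact ⟨u, p, G, hu, hs, hG, hne, hI⟩

end TypeIAncientLiouville

end Literature.Analysis.FluidPDE
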